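import Mathlib
import Literature.Computability.AlgebraicComplexity.NestFreeMatchingPoly
import Literature.Computability.AlgebraicComplexity.ArithCircuitProofs
import Summits.ValiantsHypothesis.ValiantsHypothesis.Theorems.FifoMatchingNNDivisionHardStackPowersQueue
import HarnessLib

/-!
# Route FifoMatching — crux `NNDivisionHard` (stmt-ValiantsHypothesis-21181): UNIVERSAL BLOCK TRANSPORT — every certificate
# for `NN_n` restricts to a certificate for `NN_{⌈n/3⌉}` on the left block, at polynomial cost

The transport rung of `…NNDivisionHardBlockTransport` needs the `w`-top face of the cofactor to be `x^β · ι(f)`.  Here the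
hypothesis is REMOVED by a lexicographic tie-break: after the pinned rainbow top `top_w`, take successively the top component
in the 0/1 direction of every OUTSIDE arc (an arc not inside the left block `[0, 2a)²`).  These directions vanish on the face
`x^{pins} · ι(NN_a)` (which is therefore untouched), are free and multiplicative over `ℝ≥0`, and leave a polynomial all of whose
monomials AGREE OUTSIDE the left block, i.e. one of the form `x^β · ι(f)`:

* `iterTop`, `complexity_iterTop_le`, `iterTop_mul`, `iterTop_ne_zero`, `support_iterTop_subset`, `iterTop_eq_self`,
  `apply_eq_of_mem_support_iterTop` — the tie-break and its bookkeeping;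
* `eq_monomial_mul_rename_of_agree` — a polynomial whose monomials agree outside the block is `x^β · ι(f)`;
* ★★ `exists_transport` — **for `4a+2 ≤ 2n`, `n ≤ 3a+1` and EVERY cofactor `h ≠ 0` there is `f ≠ 0` on the left block with
  `L₊(NN_a · f) ≤ 16((2n+1)(L₊(NN_n · h)+1))²` and `L₊(f) ≤ 16((2n+1)(L₊(h)+1))²`.**

So the class of quasi-polynomial certificates is closed under «restrict to the left third»; the generic rung (`f` a constant)
and the mixed-power rung (`f = c·NN_a^j`) of the sibling files are the two computed instances.  By itself the transport is a
SELF-REDUCTION (scale `n → a`, cost polynomial), not a lower bound.  HONEST FRAMING: engine-level; stmt-21181 stays OPEN; nothing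
here bears on `NNNotVP` or on VP ≠ VNP (NOT proved).
References: Jukna–Seiwert–Sergeev 2022 Thm 1 [JuknaSeiwertSergeev2022]; Hrubeš–Yehudayoff 2021 §6 Problem 2 [HrubesYehudayoff2021].
-/

noncomputable section

-- Sub = Summit single-conjunct layout: the duplicated namespace component is mandated by the tree.
set_option linter.dupNamespace false
set_option autoImplicit false

namespace Summit.ValiantsHypothesis.ValiantsHypothesis.Theorems.FifoMatching.NNDivisionHard.UniversalTransport

open Finset MvPolynomial Literature.Computability.AlgebraicComplexity
open Summit.ValiantsHypothesis.ValiantsHypothesis.Theorems.ZeroOneTransfer.Negative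
  (topComponent coeff_topComponent topComponent_mul complexity_topComponent_le topComponent_ne_zero
    support_topComponent_subset topComponent_eq_self_of_isWeightedHomogeneous)
open Summit.ValiantsHypothesis.ValiantsHypothesis.Theorems.FifoMatching.NNDivisionHard.StackPowersQueue
  (prWeight pinExp pinOpeners pinFin blockEmb blockEmb_injective topComponent_eq)
open Summit.ValiantsHypothesis.ValiantsHypothesis.Theorems.DivisionGap.PerCofactorDegreeReduction.MonomialStripping
  (complexity_le_of_monomial_mul)
open scoped NNReal BigOperators

/-! ### §1 Iterated 0/1 tie-breaks -/

section IterTop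

variable {σ : Type*} [DecidableEq σ]

/-- The 0/1 direction of one variable. [folklore] -/
def indWeight (e : σ) : σ → ℕ := fun x => if x = e then 1 else 0

/-- The weight of `m` in the 0/1 direction of `e` is the exponent `m e`. [folklore] -/
theorem weight_indWeight (e : σ) (m : σ →₀ ℕ) : Finsupp.weight (indWeight e) m = m e := by
  rw [Finsupp.weight_apply, Finsupp.sum]
  simp only [indWeight, smul_eq_mul, mul_ite, mul_one, mul_zero]
  rw [Finset.sum_ite_eq']
  split_ifs with h
  · rfl
  · exact (Finsupp.notMem_support_iff.1 h).symm

/-- ITERATED TIE-BREAK: successively take the top component in the 0/1 direction of each variable of the list. [folklore] -/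
def iterTop (l : List σ) (q : MvPolynomial σ ℝ≥0) : MvPolynomial σ ℝ≥0 :=
  l.foldr (fun e r => topComponent (indWeight e) r) q

/-- Unfolding. [folklore] -/
theorem iterTop_cons (e : σ) (l : List σ) (q : MvPolynomial σ ℝ≥0) :
    iterTop (e :: l) q = topComponent (indWeight e) (iterTop l q) := rfl

/-- Tie-breaks are free for monotone circuits. [folklore] -/
theorem complexity_iterTop_le (l : List σ) (q : MvPolynomial σ ℝ≥0) : complexity (iterTop l q) ≤ complexity q := by
  induction l with
  | nil => exact le_rfl
  | cons e l ih => exact (complexity_topComponent_le (indWeight e) _).trans ih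

/-- Tie-breaks are multiplicative over `ℝ≥0`. [folklore] -/
theorem iterTop_mul (l : List σ) (p q : MvPolynomial σ ℝ≥0) : iterTop l (p * q) = iterTop l p * iterTop l q := by
  induction l with
  | nil => rfl
  | cons e l ih => rw [iterTop_cons, iterTop_cons, iterTop_cons, ih, topComponent_mul]

/-- Tie-breaks of a nonzero polynomial are nonzero. [folklore] -/
theorem iterTop_ne_zero (l : List σ) {q : MvPolynomial σ ℝ≥0} (hq : q ≠ 0) : iterTop l q ≠ 0 := by
  induction l with
  | nil => exact hq
  | cons e l ih => exact topComponent_ne_zero (indWeight e) ih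

/-- Tie-breaks are sub-sums. [folklore] -/
theorem support_iterTop_subset (l : List σ) (q : MvPolynomial σ ℝ≥0) : (iterTop l q).support ⊆ q.support := by
  induction l with
  | nil => exact subset_rfl
  | cons e l ih => exact (support_topComponent_subset (indWeight e) _).trans ih

/-- A polynomial all of whose monomials have the same exponent at every variable of the list is untouched. [folklore] -/
theorem iterTop_eq_self (l : List σ) (p : MvPolynomial σ ℝ≥0)
    (hp : ∀ e ∈ l, ∀ m ∈ p.support, ∀ m' ∈ p.support, m e = m' e) : iterTop l p = p := by
  induction l with
  | nil => rfl
  | cons e l ih =>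
    have ih' := ih fun e' he' => hp e' (List.mem_cons_of_mem _ he')
    rw [iterTop_cons, ih']
    by_cases h0 : p = 0
    · rw [h0]; exact Summit.ValiantsHypothesis.ValiantsHypothesis.Theorems.ZeroOneTransfer.Negative.topComponent_zero _
    obtain ⟨m₀, hm₀⟩ := support_nonempty.2 h0
    refine topComponent_eq_self_of_isWeightedHomogeneous (indWeight e) (n := m₀ e) fun m hm => ?_
    rw [weight_indWeight]
    exact hp e List.mem_cons_self m (mem_support_iff.2 hm) m₀ hm₀

/-- After the tie-breaks, all monomials AGREE at every variable of the list. [folklore] -/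
theorem apply_eq_of_mem_support_iterTop (l : List σ) (q : MvPolynomial σ ℝ≥0) :
    ∀ e ∈ l, ∀ m ∈ (iterTop l q).support, ∀ m' ∈ (iterTop l q).support, m e = m' e := by
  induction l with
  | nil => intro e he; simp at he
  | cons e₀ l ih =>
    intro e he m hm m' hm'
    rw [iterTop_cons] at hm hm'
    rcases List.mem_cons.1 he with rfl | he'
    · -- the last tie-break fixes the exponent at `e`
      classical
      have key : ∀ d ∈ (topComponent (indWeight e) (iterTop l q)).support,
          d e = weightedTotalDegree (indWeight e) (iterTop l q) := by
        intro d hd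
        rw [mem_support_iff, coeff_topComponent] at hd
        split_ifs at hd with h
        · rw [← h, weight_indWeight]
        · exact absurd rfl hd
      rw [key m hm, key m' hm']
    · exact ih e he' m (support_topComponent_subset _ _ hm) m' (support_topComponent_subset _ _ hm')

end IterTop

/-! ### §2 Splitting a polynomial whose monomials agree outside the block -/

variable {n a : ℕ}

/-- A polynomial on the arcs of `[0, 2n)` all of whose monomials agree on every arc OUTSIDE the image of the block embedding
`ι` is `x^β · ι(f)` for a nonzero `f` on the block (when nonzero). [folklore] -/
theorem eq_monomial_mul_rename_of_agree (hle : 2 * a ≤ 2 * n)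
    (F : MvPolynomial (Fin (2 * n) × Fin (2 * n)) ℝ≥0) (hF : F ≠ 0)
    (hagree : ∀ e : Fin (2 * n) × Fin (2 * n), e ∉ Set.range (blockEmb hle) →
      ∀ m ∈ F.support, ∀ m' ∈ F.support, m e = m' e) :
    ∃ (β : (Fin (2 * n) × Fin (2 * n)) →₀ ℕ) (f : MvPolynomial (Fin (2 * a) × Fin (2 * a)) ℝ≥0),
      f ≠ 0 ∧ F = monomial β 1 * rename (blockEmb hle) f := by
  classical
  obtain ⟨m₀, hm₀⟩ := support_nonempty.2 hF
  have hinj := blockEmb_injective hle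
  -- the common outside part
  set β : (Fin (2 * n) × Fin (2 * n)) →₀ ℕ := m₀.filter (fun e => e ∉ Set.range (blockEmb hle)) with hβ
  -- the inside parts
  set f : MvPolynomial (Fin (2 * a) × Fin (2 * a)) ℝ≥0 :=
    ∑ m ∈ F.support, monomial (m.comapDomain (blockEmb hle) hinj.injOn) (coeff m F) with hf
  have hsplit : ∀ m ∈ F.support, β + Finsupp.mapDomain (blockEmb hle) (m.comapDomain (blockEmb hle) hinj.injOn) = m := by
    intro m hm
    ext e
    rw [Finsupp.add_apply]
    by_cases he : e ∈ Set.range (blockEmb hle)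
    · obtain ⟨e₀, rfl⟩ := he
      rw [Finsupp.mapDomain_apply hinj, Finsupp.comapDomain_apply, hβ, Finsupp.filter_apply, if_neg (fun h => h ⟨e₀, rfl⟩),
        zero_add]
    · rw [Finsupp.mapDomain_notin_range _ _ he, add_zero, hβ, Finsupp.filter_apply, if_pos he]
      exact hagree e he m₀ hm₀ m hm
  refine ⟨β, f, fun h0 => ?_, ?_⟩
  · -- `f ≠ 0`: its coefficient at the inside part of `m₀` is `coeff m₀ F ≠ 0`
    have hc := congrArg (coeff (m₀.comapDomain (blockEmb hle) hinj.injOn)) h0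
    rw [hf, coeff_sum, coeff_zero, Finset.sum_eq_single_of_mem m₀ hm₀] at hc
    · rw [coeff_monomial, if_pos rfl] at hc
      exact (mem_support_iff.1 hm₀) hc
    · intro m hm hne
      rw [coeff_monomial, if_neg]
      intro heq
      apply hne
      rw [← hsplit m hm, ← hsplit m₀ hm₀, heq]
  · -- `F = x^β · ι(f)`
    rw [hf, map_sum, Finset.mul_sum]
    conv_lhs => rw [F.as_sum]
    refine Finset.sum_congr rfl fun m hm => ?_
    rw [rename_monomial, monomial_mul, one_mul, hsplit m hm]

/-- The monomials of the face `x^{pins} · ι(NN_a)` agree outside the block (they are `pins + ι_*(χ_N)`). [folklore] -/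
theorem face_agree (hle : 2 * a ≤ 2 * n) (g : MvPolynomial (Fin (2 * a) × Fin (2 * a)) ℝ≥0)
    (e : Fin (2 * n) × Fin (2 * n)) (he : e ∉ Set.range (blockEmb hle)) :
    ∀ m ∈ (monomial (pinExp n a) (1 : ℝ≥0) * rename (blockEmb hle) g).support,
      ∀ m' ∈ (monomial (pinExp n a) (1 : ℝ≥0) * rename (blockEmb hle) g).support, m e = m' e := by
  classical
  have key : ∀ m ∈ (monomial (pinExp n a) (1 : ℝ≥0) * rename (blockEmb hle) g).support, m e = pinExp n a e := by
    intro m hm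
    obtain ⟨u, hu, v, hv, rfl⟩ := Finset.mem_add.1 (support_mul _ _ hm)
    rw [support_monomial, if_neg one_ne_zero, Finset.mem_singleton] at hu
    subst hu
    rw [support_rename_of_injective (blockEmb_injective hle), Finset.mem_image] at hv
    obtain ⟨d, -, rfl⟩ := hv
    rw [Finsupp.add_apply, Finsupp.mapDomain_notin_range _ _ he, add_zero]
  intro m hm m' hm'
  rw [key m hm, key m' hm']

/-! ### §3 Universal transport -/

/-- ★★ **UNIVERSAL BLOCK TRANSPORT.**  For `4a+2 ≤ 2n`, `n ≤ 3a+1` and EVERY cofactor `h ≠ 0` there is a nonzero polynomial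
`f` on the arcs of the left block `[0, 2a)` with `L₊(NN_a · f) ≤ 16((2n+1)(L₊(NN_n · h)+1))²` and
`L₊(f) ≤ 16((2n+1)(L₊(h)+1))²`: every certificate for `NN_n` restricts to one for `NN_a` at polynomial cost (pinned rainbow
top, lexicographic tie-break over the outside arcs, face identification, Jukna–Seiwert–Sergeev stripping, injective renaming).
[cite: JuknaSeiwertSergeev2022, Thm 1] [cite: HrubesYehudayoff2021, §6 Problem 2] -/
theorem exists_transport (h1 : 4 * a + 2 ≤ 2 * n) (h2 : n ≤ 3 * a + 1) (hle : 2 * a ≤ 2 * n)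
    {h : MvPolynomial (Fin (2 * n) × Fin (2 * n)) ℝ≥0} (hh : h ≠ 0) :
    ∃ f : MvPolynomial (Fin (2 * a) × Fin (2 * a)) ℝ≥0, f ≠ 0 ∧
      complexity (nestFreeMatchingPoly a ℝ≥0 * f) ≤
        16 * ((2 * n + 1) * (complexity (nestFreeMatchingPoly n ℝ≥0 * h) + 1)) ^ 2 ∧
      complexity f ≤ 16 * ((2 * n + 1) * (complexity h + 1)) ^ 2 := by
  classical
  set l := ((univ : Finset (Fin (2 * n) × Fin (2 * n))).filter
    (fun e => e ∉ Set.range (blockEmb hle))).toList with hl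
  have hmem : ∀ e : Fin (2 * n) × Fin (2 * n), e ∈ l ↔ e ∉ Set.range (blockEmb hle) := by
    intro e
    rw [hl, Finset.mem_toList, Finset.mem_filter]
    exact ⟨fun h => h.2, fun h => ⟨mem_univ _, h⟩⟩
  set F := iterTop l (topComponent (prWeight n a) h) with hFdef
  have hF : F ≠ 0 := iterTop_ne_zero l (topComponent_ne_zero _ hh)
  have hagree : ∀ e : Fin (2 * n) × Fin (2 * n), e ∉ Set.range (blockEmb hle) →
      ∀ m ∈ F.support, ∀ m' ∈ F.support, m e = m' e :=
    fun e he => apply_eq_of_mem_support_iterTop l _ e ((hmem e).2 he)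
  obtain ⟨β, f, hf0, hFeq⟩ := eq_monomial_mul_rename_of_agree hle F hF hagree
  have hren : ∀ g : MvPolynomial (Fin (2 * a) × Fin (2 * a)) ℝ≥0,
      complexity (rename (blockEmb hle) g) = complexity g :=
    fun g => complexity_rename_of_injective_holds (blockEmb_injective hle) g
  refine ⟨f, hf0, ?_, ?_⟩
  · have H := (complexity_iterTop_le l _).trans
      (complexity_topComponent_le (prWeight n a) (nestFreeMatchingPoly n ℝ≥0 * h))
    rw [topComponent_mul, iterTop_mul, topComponent_eq h1 h2 hle,
      iterTop_eq_self l _ (fun e he => face_agree hle _ e ((hmem e).1 he)), ← hFdef, hFeq] at H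
    have heq : monomial (pinExp n a) (1 : ℝ≥0) * rename (blockEmb hle) (nestFreeMatchingPoly a ℝ≥0) *
        (monomial β 1 * rename (blockEmb hle) f) =
        monomial (pinExp n a + β) 1 * rename (blockEmb hle) (nestFreeMatchingPoly a ℝ≥0 * f) := by
      rw [map_mul, show monomial (pinExp n a + β) (1 : ℝ≥0) = monomial (pinExp n a) 1 * monomial β 1 by
        rw [monomial_mul, one_mul]]
      ring
    rw [heq] at H
    have hstrip := complexity_le_of_monomial_mul (2 * n) (pinExp n a + β)
      (rename (blockEmb hle) (nestFreeMatchingPoly a ℝ≥0 * f))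
    rw [hren] at hstrip
    exact hstrip.trans (by gcongr)
  · have H := (complexity_iterTop_le l _).trans (complexity_topComponent_le (prWeight n a) h)
    rw [← hFdef, hFeq] at H
    have hstrip := complexity_le_of_monomial_mul (2 * n) β (rename (blockEmb hle) f)
    rw [hren] at hstrip
    exact hstrip.trans (by gcongr)

/-- ★★ **UNIVERSAL TRANSPORT at the canonical block size** `a = ⌊(n+2)/3⌋` (`n ≥ 7`). [cite: JuknaSeiwertSergeev2022, Thm 1] -/
theorem exists_transport_third {n : ℕ} (hn : 7 ≤ n) {h : MvPolynomial (Fin (2 * n) × Fin (2 * n)) ℝ≥0} (hh : h ≠ 0) :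
    ∃ f : MvPolynomial (Fin (2 * ((n + 2) / 3)) × Fin (2 * ((n + 2) / 3))) ℝ≥0, f ≠ 0 ∧
      complexity (nestFreeMatchingPoly ((n + 2) / 3) ℝ≥0 * f) ≤
        16 * ((2 * n + 1) * (complexity (nestFreeMatchingPoly n ℝ≥0 * h) + 1)) ^ 2 ∧
      complexity f ≤ 16 * ((2 * n + 1) * (complexity h + 1)) ^ 2 :=
  exists_transport (by omega) (by omega) (by omega) hh

end Summit.ValiantsHypothesis.ValiantsHypothesis.Theorems.FifoMatching.NNDivisionHard.UniversalTransport

end
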